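import Summits.QuantumFields.YangMills.Theorems.UnitScaleTiltAvgCurvGradWords
import Summits.QuantumFields.YangMills.Theorems.UnitScaleTiltMinimiserStabilityRegPrAvgActionDefect
import Literature.MathematicalPhysics.QuantumFieldTheory.Balaban1983to89.B10Eq68TorusRegularity
import HarnessLib

/-!
# Route `UnitScaleTilt`, crux K1 child «MinimiserStabilityRegPr» (stmt-QuantumFields-19200), registered stub `stub_smoothLift` (G-K1a-2′) — helper:
# STABILITY OF THE THREE CLAUSES OF `SmoothLiftAt` UNDER BONDWISE PERTURBATIONS OF THE FINE FIELD — transports along words, plaquette variables,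
# backward covariant derivatives of the plaquette field, and the `SU(2)` Wilson action, for two configurations within `δ` of each other bond by bond

Cell `ym3-torus` ∕ fleet seat `ym-ust-19200-p1` (HUMAN RULING D-0037, YM ladder rung R3).  The located content of `stub_smoothLift` is the SMOOTH regime
`0 ≤ b < a` (`SmoothLift.smoothLiftAt_of_smooth`, p441624): an exact one-step lift `U″` of a slowly varying coarse field with (ii) small plaquettes, (iii)
small curvature gradients, (iv) `L·A(U″) ≤ A(U) + C₂(b² + ab + a³)·#Plaq`.  The intended witness is a smooth interpolant `U₁` corrected to exactness,
`U″ = U₁·g` with a bondwise correction `‖g − 1‖ ≤ δ = O(b + a²)` (right inverse of the linearised (0.4) average, [Balaban1985Averaging] Props 3–4).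
This file supplies, once and for all, the transfer of (ii)–(iv) from `U₁` to any `U″` within `δ` of it bond by bond (`SU(N)` read in `M_N(ℂ)`):
* §1 `norm_coe_holT_sub_le` — transports along a word `w` differ by `≤ |w|·δ`; plaquette variables by `≤ 4δ` (`plaqSmall_of_near`).
* §2 `covDerivT_plaqFT_eq_coe'` (the `SU(N)` reading of [Balaban1985RegularSpaces] (1.1) for the plaquette field, both orientations) and
  **`norm_covDerivT_plaqFT_le_of_near`** — backward covariant derivatives of the plaquette field differ by `≤ 10δ`.
* §3 **`abs_wilsonAction4_sub_le_of_near`** (`SU(2)`, `1 − Re tr = ½|· − 1|²`): `|A(V′) − A(V)| ≤ #Plaq·4δ(a + 2δ)` when `V` has plaquettes `< a` —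
  the shape `aδ + δ²` that the budget `C₂(b² + ab + a³)` of (iv) absorbs for `δ = O(b + a²)`.

Elementary (our own statements, [folklore] / cited to the printed identities they instantiate).

References: T. Bałaban, CMP 98 (1985) 17–51 [Balaban1985Averaging] ((9) p.19, (19)–(20) p.21, Props 3–4 p.36); CMP 99 (1985) 75–102
[Balaban1985RegularSpaces] ((1.1) p.76); CMP 109 (1987) 249–301 [Balaban1987RG1] ((0.14) p.254).
-/

noncomputable section

open scoped BigOperators Matrix.Norms.L2Operator

namespace Summit.QuantumFields.YangMills.Theorems.SmoothLiftPerturbation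

open Literature.MathematicalPhysics.QuantumFieldTheory.Balaban1983to89
open B7Prop1Explicit (plaqWord)
open B7Eq78Linearization (conjR conjR_apply)
open B10Eq27TorusAxialLog (holT holT_cons_true holT_cons_false holT_nil unitsField toUField val_unitsField holT_plaqWord_eq_plaqHol
  holT_plaqWord_swap val_holT_unitsField holT_toUField suIncl val_suIncl)
open B10Eq68TorusRegularity (plaqFT covDerivT)
open Summit.QuantumFields.YangMills.Theorems.AvgCurvGrad (norm_coe_su norm_coe_mul_sub_mul_le norm_coe_inv_sub_inv norm_sub_le_of_mid)
open Summit.QuantumFields.YangMills.Theorems.AvgActionDefect (one_sub_reTr_eq_half_dist1_sq_su2)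

/-! ## §1 Transports along words and plaquette variables -/

section Words

variable {P : Params} {s : ℕ} {N : ℕ} [NeZero N]

/-- **TRANSPORTS OF NEARBY CONFIGURATIONS**: if `‖V′(b) − V(b)‖ ≤ δ` at every bond then along any word `w` the transports differ by `≤ |w|·δ`
(products of unitaries: `‖g₁g₂ − h₁h₂‖ ≤ ‖g₁ − h₁‖ + ‖g₂ − h₂‖`, `‖g⁻¹ − h⁻¹‖ = ‖g − h‖`). [cite: Balaban1985Averaging, (9) p.19 and (19)-(20) p.21] -/
theorem norm_coe_holT_sub_le (V V' : GaugeField P s (Matrix.specialUnitaryGroup (Fin N) ℂ)) {δ : ℝ}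
    (hδ : ∀ b : PBond P s, ‖((V' b : Matrix.specialUnitaryGroup (Fin N) ℂ) : Matrix (Fin N) (Fin N) ℂ) - (V b : Matrix (Fin N) (Fin N) ℂ)‖ ≤ δ) :
    ∀ (x : Site P s) (w : List (B7Prop1Explicit.Letter P.d)),
      ‖((holT V' x w : Matrix.specialUnitaryGroup (Fin N) ℂ) : Matrix (Fin N) (Fin N) ℂ) - ((holT V x w : Matrix.specialUnitaryGroup (Fin N) ℂ) :
        Matrix (Fin N) (Fin N) ℂ)‖ ≤ (w.length : ℝ) * δ
  | x, [] => by simp [holT_nil]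
  | x, (μ, true) :: w => by
    rw [holT_cons_true, holT_cons_true, List.length_cons, Nat.cast_succ, add_mul, one_mul, add_comm]
    exact (norm_coe_mul_sub_mul_le _ _ _ _).trans (add_le_add (hδ _) (norm_coe_holT_sub_le V V' hδ (x.shift μ) w))
  | x, (μ, false) :: w => by
    rw [holT_cons_false, holT_cons_false, List.length_cons, Nat.cast_succ, add_mul, one_mul, add_comm]
    exact (norm_coe_mul_sub_mul_le _ _ _ _).trans
      (add_le_add ((norm_coe_inv_sub_inv _ _).le.trans (hδ _)) (norm_coe_holT_sub_le V V' hδ (x.unshift μ) w))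

/-- **PLAQUETTE VARIABLES OF NEARBY CONFIGURATIONS** differ by `≤ 4δ`: `dist1 (V′(∂p)) ≤ dist1 (V(∂p)) + 4δ`. [cite: Balaban1985Averaging, (9) p.19 and (19)-(20) p.21] -/
theorem dist1_plaqHol_le_of_near (V V' : GaugeField P s (Matrix.specialUnitaryGroup (Fin N) ℂ)) {δ : ℝ}
    (hδ : ∀ b : PBond P s, ‖((V' b : Matrix.specialUnitaryGroup (Fin N) ℂ) : Matrix (Fin N) (Fin N) ℂ) - (V b : Matrix (Fin N) (Fin N) ℂ)‖ ≤ δ)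
    (p : Plaq P s) : dist1 (GaugeField.plaqHol V' p) ≤ dist1 (GaugeField.plaqHol V p) + 4 * δ := by
  have h := norm_coe_holT_sub_le V V' hδ p.src (plaqWord p.μ p.ν)
  rw [holT_plaqWord_eq_plaqHol, holT_plaqWord_eq_plaqHol] at h
  have hlen : ((plaqWord p.μ p.ν : List (B7Prop1Explicit.Letter P.d)).length : ℝ) = 4 := by simp [plaqWord]
  rw [hlen] at h
  have hd : dist1 (GaugeField.plaqHol V' p) = ‖((GaugeField.plaqHol V' p : Matrix.specialUnitaryGroup (Fin N) ℂ) : Matrix (Fin N) (Fin N) ℂ) - 1‖ := rfl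
  have hd' : dist1 (GaugeField.plaqHol V p) = ‖((GaugeField.plaqHol V p : Matrix.specialUnitaryGroup (Fin N) ℂ) : Matrix (Fin N) (Fin N) ℂ) - 1‖ := rfl
  rw [hd, hd']
  calc _ ≤ ‖((GaugeField.plaqHol V' p : Matrix.specialUnitaryGroup (Fin N) ℂ) : Matrix (Fin N) (Fin N) ℂ) -
          ((GaugeField.plaqHol V p : Matrix.specialUnitaryGroup (Fin N) ℂ) : Matrix (Fin N) (Fin N) ℂ)‖ +
        ‖((GaugeField.plaqHol V p : Matrix.specialUnitaryGroup (Fin N) ℂ) : Matrix (Fin N) (Fin N) ℂ) - 1‖ := norm_sub_le_of_mid _ _ _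
    _ ≤ _ := by linarith

/-- Hence `PlaqSmall a V ⇒ PlaqSmall (a + 4δ) V′`. [cite: Balaban1985Averaging, (19)-(20) p.21] -/
theorem plaqSmall_of_near {V V' : GaugeField P s (Matrix.specialUnitaryGroup (Fin N) ℂ)} {δ a : ℝ}
    (hδ : ∀ b : PBond P s, ‖((V' b : Matrix.specialUnitaryGroup (Fin N) ℂ) : Matrix (Fin N) (Fin N) ℂ) - (V b : Matrix (Fin N) (Fin N) ℂ)‖ ≤ δ)
    (hV : PlaqSmall a V) : PlaqSmall (a + 4 * δ) V' :=
  fun p => (dist1_plaqHol_le_of_near V V' hδ p).trans_lt (by linarith [hV p])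

end Words

/-! ## §2 Backward covariant derivatives of the plaquette field -/

section Gradient

variable {P : Params} {s : ℕ} {N : ℕ}

/-- **THE `SU(N)` READING OF (1.1) FOR THE PLAQUETTE FIELD** (both orientations at once): for an `SU(N)`-valued configuration `W` read in `M_N(ℂ)`,
`(D¹*_{W,ν}∂W)_{κκ′}(x) = W(x−e_ν,x)⁻¹·W(∂p_{κκ′}(x−e_ν))·W(x−e_ν,x) − W(∂p_{κκ′}(x))` with `W(∂p_{κκ′}(z))` the transport along `plaqWord κ κ′` from `z`.
[cite: Balaban1985RegularSpaces, (1.1) p.76] -/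
theorem covDerivT_plaqFT_eq_coe' (W : GaugeField P s (Matrix.specialUnitaryGroup (Fin N) ℂ)) (ν κ κ' : Fin P.d) (x : Site P s) :
    covDerivT 1 (unitsField (toUField W)) ν (plaqFT (unitsField (toUField W)) κ κ') x =
      (((W ⟨x.unshift ν, ν⟩)⁻¹ * holT W (x.unshift ν) (plaqWord κ κ') * W ⟨x.unshift ν, ν⟩ :
          Matrix.specialUnitaryGroup (Fin N) ℂ) : Matrix (Fin N) (Fin N) ℂ) -
        ((holT W x (plaqWord κ κ') : Matrix.specialUnitaryGroup (Fin N) ℂ) : Matrix (Fin N) (Fin N) ℂ) := by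
  unfold covDerivT plaqFT
  rw [inv_one, one_smul, conjR_apply, inv_inv, val_holT_unitsField, val_holT_unitsField, holT_toUField, holT_toUField, val_suIncl,
    val_suIncl]
  have hinv : (((unitsField (toUField W) ⟨x.unshift ν, ν⟩)⁻¹ : (Matrix (Fin N) (Fin N) ℂ)ˣ) : Matrix (Fin N) (Fin N) ℂ) =
      (((W ⟨x.unshift ν, ν⟩)⁻¹ : Matrix.specialUnitaryGroup (Fin N) ℂ) : Matrix (Fin N) (Fin N) ℂ) :=
    Units.inv_eq_of_mul_eq_one_right (by
      show ((W ⟨x.unshift ν, ν⟩ : Matrix.specialUnitaryGroup (Fin N) ℂ) : Matrix (Fin N) (Fin N) ℂ) *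
          star ((W ⟨x.unshift ν, ν⟩ : Matrix.specialUnitaryGroup (Fin N) ℂ) : Matrix (Fin N) (Fin N) ℂ) = 1
      exact Matrix.mem_unitaryGroup_iff.mp (W ⟨x.unshift ν, ν⟩).2.1)
  rw [hinv, val_unitsField]
  rfl

variable [NeZero N]

omit [NeZero N] in
/-- `‖T′ − Q′‖ ≤ ‖T − Q‖ + ‖T′ − T‖ + ‖Q′ − Q‖` (triangle inequality). [folklore] -/
private theorem norm_sub_le_perturb (T T' Q Q' : Matrix (Fin N) (Fin N) ℂ) : ‖T' - Q'‖ ≤ ‖T - Q‖ + ‖T' - T‖ + ‖Q' - Q‖ := by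
  have hid : T' - Q' = (T - Q) + (T' - T) - (Q' - Q) := by abel
  rw [hid]
  exact (norm_sub_le _ _).trans (add_le_add (norm_add_le _ _) le_rfl)

/-- **BACKWARD COVARIANT DERIVATIVES OF THE PLAQUETTE FIELD OF NEARBY CONFIGURATIONS** differ by `≤ 10δ`
(`1 + 4 + 1` bonds in the transported plaquette, `4` in the plaquette). [cite: Balaban1985RegularSpaces, (1.1) p.76] -/
theorem norm_covDerivT_plaqFT_le_of_near (V V' : GaugeField P s (Matrix.specialUnitaryGroup (Fin N) ℂ)) {δ : ℝ}
    (hδ : ∀ b : PBond P s, ‖((V' b : Matrix.specialUnitaryGroup (Fin N) ℂ) : Matrix (Fin N) (Fin N) ℂ) - (V b : Matrix (Fin N) (Fin N) ℂ)‖ ≤ δ)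
    (ν κ κ' : Fin P.d) (x : Site P s) :
    ‖covDerivT 1 (unitsField (toUField V')) ν (plaqFT (unitsField (toUField V')) κ κ') x‖ ≤
      ‖covDerivT 1 (unitsField (toUField V)) ν (plaqFT (unitsField (toUField V)) κ κ') x‖ + 10 * δ := by
  rw [covDerivT_plaqFT_eq_coe', covDerivT_plaqFT_eq_coe']
  have h4 : ((plaqWord κ κ' : List (B7Prop1Explicit.Letter P.d)).length : ℝ) = 4 := by simp [plaqWord]
  have hP : ∀ z : Site P s, ‖((holT V' z (plaqWord κ κ') : Matrix.specialUnitaryGroup (Fin N) ℂ) : Matrix (Fin N) (Fin N) ℂ) -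
      ((holT V z (plaqWord κ κ') : Matrix.specialUnitaryGroup (Fin N) ℂ) : Matrix (Fin N) (Fin N) ℂ)‖ ≤ 4 * δ := fun z => by
    have h := norm_coe_holT_sub_le V V' hδ z (plaqWord κ κ')
    rwa [h4] at h
  have hT : ‖(((V' ⟨x.unshift ν, ν⟩)⁻¹ * holT V' (x.unshift ν) (plaqWord κ κ') * V' ⟨x.unshift ν, ν⟩ : Matrix.specialUnitaryGroup (Fin N) ℂ) :
        Matrix (Fin N) (Fin N) ℂ) -
      (((V ⟨x.unshift ν, ν⟩)⁻¹ * holT V (x.unshift ν) (plaqWord κ κ') * V ⟨x.unshift ν, ν⟩ : Matrix.specialUnitaryGroup (Fin N) ℂ) :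
        Matrix (Fin N) (Fin N) ℂ)‖ ≤ 6 * δ := by
    refine (norm_coe_mul_sub_mul_le _ _ _ _).trans ?_
    have h1 := (norm_coe_mul_sub_mul_le ((V' ⟨x.unshift ν, ν⟩)⁻¹) (holT V' (x.unshift ν) (plaqWord κ κ')) ((V ⟨x.unshift ν, ν⟩)⁻¹)
      (holT V (x.unshift ν) (plaqWord κ κ'))).trans (add_le_add ((norm_coe_inv_sub_inv _ _).le.trans (hδ _)) (hP _))
    linarith [hδ ⟨x.unshift ν, ν⟩]
  refine (norm_sub_le_perturb
    (((V ⟨x.unshift ν, ν⟩)⁻¹ * holT V (x.unshift ν) (plaqWord κ κ') * V ⟨x.unshift ν, ν⟩ : Matrix.specialUnitaryGroup (Fin N) ℂ) :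
      Matrix (Fin N) (Fin N) ℂ) _
    ((holT V x (plaqWord κ κ') : Matrix.specialUnitaryGroup (Fin N) ℂ) : Matrix (Fin N) (Fin N) ℂ) _).trans ?_
  linarith [hT, hP x]

end Gradient

/-! ## §3 The `SU(2)` Wilson action -/

section Action

variable {P : Params} {s : ℕ}

/-- Real arithmetic of one plaquette: `|½d′² − ½d²| ≤ 4δ(a + 2δ)` if `|d′ − d| ≤ 4δ`, `0 ≤ d < a`, `0 ≤ d′`. [folklore] -/
private theorem abs_half_sq_sub_le {d d' a δ : ℝ} (hd : 0 ≤ d) (hd' : 0 ≤ d') (hda : d < a) (h₁ : d' ≤ d + 4 * δ) (h₂ : d ≤ d' + 4 * δ) :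
    |1 / 2 * d' ^ 2 - 1 / 2 * d ^ 2| ≤ 4 * δ * (a + 2 * δ) := by
  rw [abs_le]
  constructor <;> nlinarith

/-- **THE `SU(2)` WILSON ACTIONS OF NEARBY CONFIGURATIONS**: if `‖V′(b) − V(b)‖ ≤ δ` at every bond and `V` has plaquettes `< a`, then
`|A(V′) − A(V)| ≤ #Plaq·4δ(a + 2δ)` (`1 − Re tr = ½|· − 1|²` on `SU(2)`, [Balaban1987RG1] (0.14); per plaquette `½|d′² − d²| ≤ ½·4δ·(2a + 4δ)`).
[cite: Balaban1987RG1, (0.14) p.254] -/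
theorem abs_wilsonAction4_sub_le_of_near (V V' : GaugeField P s (Matrix.specialUnitaryGroup (Fin 2) ℂ)) {δ a : ℝ}
    (hδ : ∀ b : PBond P s, ‖((V' b : Matrix.specialUnitaryGroup (Fin 2) ℂ) : Matrix (Fin 2) (Fin 2) ℂ) - (V b : Matrix (Fin 2) (Fin 2) ℂ)‖ ≤ δ)
    (hV : PlaqSmall a V) :
    |wilsonAction4 V' - wilsonAction4 V| ≤ (Fintype.card (Plaq P s) : ℝ) * (4 * δ * (a + 2 * δ)) := by
  have hA : ∀ W : GaugeField P s (Matrix.specialUnitaryGroup (Fin 2) ℂ),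
      wilsonAction4 W = ∑ p : Plaq P s, 1 / 2 * dist1 (GaugeField.plaqHol W p) ^ 2 := fun W => by
    simp only [wilsonAction4, wilsonAction, one_mul, one_sub_reTr_eq_half_dist1_sq_su2]
  rw [hA, hA, ← Finset.sum_sub_distrib]
  refine (Finset.abs_sum_le_sum_abs _ _).trans ?_
  have hper : ∀ p ∈ (Finset.univ : Finset (Plaq P s)),
      |1 / 2 * dist1 (GaugeField.plaqHol V' p) ^ 2 - 1 / 2 * dist1 (GaugeField.plaqHol V p) ^ 2| ≤ 4 * δ * (a + 2 * δ) := by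
    intro p _
    have hup := dist1_plaqHol_le_of_near V V' hδ p
    have hdown := dist1_plaqHol_le_of_near V' V (fun b => by rw [norm_sub_rev]; exact hδ b) p
    exact abs_half_sq_sub_le (GaugeGroup.dist1_nonneg _) (GaugeGroup.dist1_nonneg _) (hV p) hup hdown
  refine (Finset.sum_le_sum hper).trans (le_of_eq ?_)
  rw [Finset.sum_const, Finset.card_univ, nsmul_eq_mul]

end Action

end Summit.QuantumFields.YangMills.Theorems.SmoothLiftPerturbation

end
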